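import Literature.MathematicalPhysics.QuantumLattice.TIVariationalPressure
import Literature.MathematicalPhysics.QuantumLattice.TorusLimitOfMixturesCompactness
import HarnessLib

/-!
# Energy–entropy convexity in the temperature for torus limits of the canonical sector Gibbs states of the 2D `t–t'` Hubbard model:
# the Clausius bracket, energy AND entropy antitone in `β` (no common torus sequence), interval sockets

Family `hubbard` (topic `MathematicalPhysics/QuantumLattice`; sequel of `TIVariationalPressure.lean` — the canonical constrained variational
bound `s̄(ω) − β·e_Φ(ω) ≤ p(β; t,t',U; ρ(ω))` for translation-invariant `ω` (`InfVolFermionState.IsTranslationInvariant.entropyDensitySup_sub_mul_le_pressureTT'`)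
and its ATTAINMENT by every torus limit of the canonical sector Gibbs states at its own `β`
(`InfVolFermionState.IsTorusLimitOfMixture.entropyDensitySup_sub_mul_eq_pressureTT'_of_sectorGibbs`) — and of `TorusSectorGibbsEnergyWindow.lean`).
Everything is PROVED; no definition, no named fact, no `sorry`.

Throughout, `ω₁` is a torus limit of the canonical sector Gibbs states `(rectN n L, S^z = 0)` of `H_L(t,t',U)` at inverse temperature `β₁ > 0` along SOME
`Ls₁ → ∞`, `ω₂` the same at `β₂ > 0` along SOME `Ls₂ → ∞` (the two torus sequences are UNRELATED), `U ≥ 0`, `0 < n < 2`;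
`eᵢ := e_{Φ(t,t',U)}(ωᵢ)` (`ω.meanEnergy (hubbardTTPrimeFermionInteraction t t' U) 1`), `s̄ᵢ := ωᵢ.entropyDensitySup`, `p(β) := pressureTT' β t t' U n`.

* §1 THE CLAUSIUS BRACKET (the concavity of the entropy as a function of the energy, in supporting-line form):
  `β₁·(e₁ − e₂) ≤ s̄₁ − s̄₂ ≤ β₂·(e₁ − e₂)` (`IsTorusLimitOfMixture.mul_sub_meanEnergy_le_entropyDensitySup_sub_of_sectorGibbs`,
  `…entropyDensitySup_sub_le_mul_sub_meanEnergy_of_sectorGibbs`). Proof: the variational bound for `ω₂` AT `β₁` reads `s̄₂ − β₁e₂ ≤ p(β₁) = s̄₁ − β₁e₁`,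
  and symmetrically for `ω₁` at `β₂`. No finite-volume argument and no common torus sequence is needed.
* §2 MONOTONICITY: for `β₁ < β₂`, `e₂ ≤ e₁` (`…meanEnergy_hubbardTTPrime_anti_of_sectorGibbs'` — the tree's
  `…meanEnergy_hubbardTTPrime_anti_of_sectorGibbs` needs a COMMON `Ls`; this one does not) and `s̄₂ ≤ s̄₁`
  (`…entropyDensitySup_anti_of_sectorGibbs`, new: the entropy density is antitone in `β`, i.e. non-decreasing in `T`); at ONE temperature
  (`β₁ = β₂`) any two torus limits lie on one supporting line: `s̄₁ − s̄₂ = β·(e₁ − e₂)` (`…entropyDensitySup_sub_eq_mul_sub_meanEnergy_of_sectorGibbs`).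
* §3 INTERVAL SOCKETS for certificate users: an energy CAP valid for every torus limit at the hot end `β₁` and an energy FLOOR valid for every
  torus limit at the cold end `β₂` bracket the energy of every torus limit at every `β ∈ [β₁, β₂]`
  (`…meanEnergy_hubbardTTPrime_mem_Icc_on_interval_of_forall`); the same for the entropy density (`…entropyDensitySup_mem_Icc_on_interval_of_forall`);
  one-sided halves (`…_le_of_forall_hot`, `…le_…_of_forall_cold`). Thermal torus limits exist at every `β`
  (`exists_isTorusLimitOfMixture_sectorGibbs_subseq`), so the endpoint hypotheses are never used vacuously.

References (locators checked against the held copies by hubbard-tc-lit-2 g21, tc INBOX l.1898): R. B. Israel, *Convexity in the Theory of Lattice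
Gases* (1979) — the finite-volume variational inequality with its equality case is Lemma II.3.1, the infinite-volume variational principle Thm. II.3.2,
attainment by invariant equilibrium states Cor. II.3.5 [cite: Israel1979, Thm. II.3.2 and Cor. II.3.5; Lemma II.3.1 (finite volume, equality case)];
D. Ruelle, *Statistical Mechanics: Rigorous Results* (1969) — lattice variational principle §7.4 Thm. 7.4.1, the entropy-versus-energy supporting-line
picture §3.4 Thm. 3.4.4 ∕ Fig. 9 [cite: Ruelle1969, §7.4 Thm. 7.4.1; cf. §3.4 Thm. 3.4.4 and Fig. 9]; S. J. Gustafson, I. M. Sigal, *Mathematical Concepts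
of Quantum Mechanics* (2003), §18.3 (equilibrium states minimise the free energy) [cite: GustafsonSigal2003, §18.3]. The Clausius bracket of §1 is not
printed as a numbered result in these sources: it is IMMEDIATE from the variational bound and its attainment (two lines), which is how it is proved here.

## Mathlib / tree search

REUSED: `InfVolFermionState.IsTranslationInvariant.entropyDensitySup_sub_mul_le_pressureTT'`, `…IsTorusLimitOfMixture.entropyDensitySup_sub_mul_eq_pressureTT'_of_sectorGibbs`
(`TIVariationalPressure`), `IsTorusLimitOfMixture.isTranslationInvariant` (`TorusLimitOfMixtures`), `IsTorusLimitOfMixture.density_eq_of_sectorGibbs`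
(`TorusSectorGibbsMixture`), `exists_isTorusLimitOfMixture_sectorGibbs_subseq` (`TorusLimitOfMixturesCompactness`). NOT restated: the common-`Ls`
antitonicity `IsTorusLimitOfMixture.meanEnergy_hubbardTTPrime_anti_of_sectorGibbs` and its interval window (`TorusSectorGibbsEnergyWindow`).
-/

noncomputable section

namespace Literature.MathematicalPhysics.QuantumLattice

open Literature.Probability.LatticeModels ThermodynamicLimit
open _root_.Filter
open scoped _root_.Topology

namespace InfVolFermionState

variable {t t' U n : ℝ}

/-! ### §1 The Clausius bracket -/

/-- **Clausius bracket, lower half**: for torus limits `ω₁` at `β₁ > 0` and `ω₂` at `β₂` of the canonical sector Gibbs states (`U ≥ 0`,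
`0 < n < 2`; unrelated torus sequences), `β₁·(e₁ − e₂) ≤ s̄₁ − s̄₂` — immediate from the variational bound for `ω₂` at `β₁` (`s̄₂ − β₁e₂ ≤ p(β₁)`) against its attainment by `ω₁`
(`p(β₁) = s̄₁ − β₁e₁`).
[cite: Israel1979, Thm. II.3.2 and Cor. II.3.5; Lemma II.3.1 (finite volume, equality case)] [cite: Ruelle1969, §7.4 Thm. 7.4.1; cf. §3.4 Thm. 3.4.4 and Fig. 9] -/
theorem IsTorusLimitOfMixture.mul_sub_meanEnergy_le_entropyDensitySup_sub_of_sectorGibbs (hU : 0 ≤ U) (hn0 : 0 < n)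
    (hn2 : n < 2) {β₁ β₂ : ℝ} (hβ₁ : 0 < β₁) {ω₁ ω₂ : InfVolFermionState 2} {Ls₁ Ls₂ : ℕ → ℕ}
    (h₁ : ω₁.IsTorusLimitOfMixture (sectorGibbsCount n) (fun L => sectorGibbsWeightTT' β₁ t t' U n L)
      (fun L => sectorGibbsVectorTT' t t' U n L) Ls₁)
    (hLs₁ : Tendsto Ls₁ atTop atTop)
    (h₂ : ω₂.IsTorusLimitOfMixture (sectorGibbsCount n) (fun L => sectorGibbsWeightTT' β₂ t t' U n L)
      (fun L => sectorGibbsVectorTT' t t' U n L) Ls₂)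
    (hLs₂ : Tendsto Ls₂ atTop atTop) :
    β₁ * (ω₁.meanEnergy (hubbardTTPrimeFermionInteraction t t' U) 1 -
        ω₂.meanEnergy (hubbardTTPrimeFermionInteraction t t' U) 1) ≤
      ω₁.entropyDensitySup - ω₂.entropyDensitySup := by
  have heq := h₁.entropyDensitySup_sub_mul_eq_pressureTT'_of_sectorGibbs t t' hU hβ₁ hn0 hn2 hLs₁
  have hρ := h₂.density_eq_of_sectorGibbs t t' U hn0.le hn2.le β₂ hLs₂
  have hle := h₂.isTranslationInvariant.entropyDensitySup_sub_mul_le_pressureTT' t t' hU hβ₁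
    (hρ.symm ▸ hn0) (hρ.symm ▸ hn2)
  rw [hρ] at hle
  linarith

/-- **Clausius bracket, upper half**: for torus limits `ω₁` at `β₁` and `ω₂` at `β₂ > 0` of the canonical sector Gibbs states (`U ≥ 0`,
`0 < n < 2`; unrelated torus sequences), `s̄₁ − s̄₂ ≤ β₂·(e₁ − e₂)`. [cite: Israel1979, Thm. II.3.2 and Cor. II.3.5; Lemma II.3.1 (finite volume, equality case)] [cite: Ruelle1969, §7.4 Thm. 7.4.1; cf. §3.4 Thm. 3.4.4 and Fig. 9] -/
theorem IsTorusLimitOfMixture.entropyDensitySup_sub_le_mul_sub_meanEnergy_of_sectorGibbs (hU : 0 ≤ U) (hn0 : 0 < n)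
    (hn2 : n < 2) {β₁ β₂ : ℝ} (hβ₂ : 0 < β₂) {ω₁ ω₂ : InfVolFermionState 2} {Ls₁ Ls₂ : ℕ → ℕ}
    (h₁ : ω₁.IsTorusLimitOfMixture (sectorGibbsCount n) (fun L => sectorGibbsWeightTT' β₁ t t' U n L)
      (fun L => sectorGibbsVectorTT' t t' U n L) Ls₁)
    (hLs₁ : Tendsto Ls₁ atTop atTop)
    (h₂ : ω₂.IsTorusLimitOfMixture (sectorGibbsCount n) (fun L => sectorGibbsWeightTT' β₂ t t' U n L)
      (fun L => sectorGibbsVectorTT' t t' U n L) Ls₂)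
    (hLs₂ : Tendsto Ls₂ atTop atTop) :
    ω₁.entropyDensitySup - ω₂.entropyDensitySup ≤
      β₂ * (ω₁.meanEnergy (hubbardTTPrimeFermionInteraction t t' U) 1 -
        ω₂.meanEnergy (hubbardTTPrimeFermionInteraction t t' U) 1) := by
  have h := h₂.mul_sub_meanEnergy_le_entropyDensitySup_sub_of_sectorGibbs hU hn0 hn2 hβ₂ hLs₂ h₁ hLs₁
  linarith

/-- **Clausius bracket** (both halves): `β₁·(e₁ − e₂) ≤ s̄₁ − s̄₂ ≤ β₂·(e₁ − e₂)` for torus limits at `β₁, β₂ > 0` — the entropy–energy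
pairs of the thermal torus limits lie on a concave curve whose supporting slopes at `β₁`, `β₂` are `β₁`, `β₂`.
[cite: Israel1979, Thm. II.3.2 and Cor. II.3.5; Lemma II.3.1 (finite volume, equality case)] [cite: Ruelle1969, §7.4 Thm. 7.4.1; cf. §3.4 Thm. 3.4.4 and Fig. 9] [cite: GustafsonSigal2003, §18.3] -/
theorem IsTorusLimitOfMixture.entropyDensitySup_sub_mem_Icc_of_sectorGibbs (hU : 0 ≤ U) (hn0 : 0 < n)
    (hn2 : n < 2) {β₁ β₂ : ℝ} (hβ₁ : 0 < β₁) (hβ₂ : 0 < β₂) {ω₁ ω₂ : InfVolFermionState 2} {Ls₁ Ls₂ : ℕ → ℕ}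
    (h₁ : ω₁.IsTorusLimitOfMixture (sectorGibbsCount n) (fun L => sectorGibbsWeightTT' β₁ t t' U n L)
      (fun L => sectorGibbsVectorTT' t t' U n L) Ls₁)
    (hLs₁ : Tendsto Ls₁ atTop atTop)
    (h₂ : ω₂.IsTorusLimitOfMixture (sectorGibbsCount n) (fun L => sectorGibbsWeightTT' β₂ t t' U n L)
      (fun L => sectorGibbsVectorTT' t t' U n L) Ls₂)
    (hLs₂ : Tendsto Ls₂ atTop atTop) :
    ω₁.entropyDensitySup - ω₂.entropyDensitySup ∈
      Set.Icc (β₁ * (ω₁.meanEnergy (hubbardTTPrimeFermionInteraction t t' U) 1 -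
          ω₂.meanEnergy (hubbardTTPrimeFermionInteraction t t' U) 1))
        (β₂ * (ω₁.meanEnergy (hubbardTTPrimeFermionInteraction t t' U) 1 -
          ω₂.meanEnergy (hubbardTTPrimeFermionInteraction t t' U) 1)) :=
  ⟨h₁.mul_sub_meanEnergy_le_entropyDensitySup_sub_of_sectorGibbs hU hn0 hn2 hβ₁ hLs₁ h₂ hLs₂,
    h₁.entropyDensitySup_sub_le_mul_sub_meanEnergy_of_sectorGibbs hU hn0 hn2 hβ₂ hLs₁ h₂ hLs₂⟩

/-! ### §2 Monotonicity in the temperature -/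

/-- **The thermal energy density is antitone in `β` — NO common torus sequence**: torus limits `ω₁` at `β₁`, `ω₂` at `β₂` of the canonical
sector Gibbs states with `0 < β₁ < β₂` (`U ≥ 0`, `0 < n < 2`) satisfy `e₂ ≤ e₁` (subtract the two halves of the Clausius bracket:
`(β₂ − β₁)(e₁ − e₂) ≥ 0`). [cite: Ruelle1969, §7.4 Thm. 7.4.1; cf. §3.4 Thm. 3.4.4 and Fig. 9] [cite: Israel1979, Thm. II.3.2 and Cor. II.3.5; Lemma II.3.1 (finite volume, equality case)] -/
theorem IsTorusLimitOfMixture.meanEnergy_hubbardTTPrime_anti_of_sectorGibbs' (hU : 0 ≤ U) (hn0 : 0 < n) (hn2 : n < 2)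
    {β₁ β₂ : ℝ} (hβ₁ : 0 < β₁) (hlt : β₁ < β₂) {ω₁ ω₂ : InfVolFermionState 2} {Ls₁ Ls₂ : ℕ → ℕ}
    (h₁ : ω₁.IsTorusLimitOfMixture (sectorGibbsCount n) (fun L => sectorGibbsWeightTT' β₁ t t' U n L)
      (fun L => sectorGibbsVectorTT' t t' U n L) Ls₁)
    (hLs₁ : Tendsto Ls₁ atTop atTop)
    (h₂ : ω₂.IsTorusLimitOfMixture (sectorGibbsCount n) (fun L => sectorGibbsWeightTT' β₂ t t' U n L)
      (fun L => sectorGibbsVectorTT' t t' U n L) Ls₂)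
    (hLs₂ : Tendsto Ls₂ atTop atTop) :
    ω₂.meanEnergy (hubbardTTPrimeFermionInteraction t t' U) 1 ≤
      ω₁.meanEnergy (hubbardTTPrimeFermionInteraction t t' U) 1 := by
  have hlo := h₁.mul_sub_meanEnergy_le_entropyDensitySup_sub_of_sectorGibbs hU hn0 hn2 hβ₁ hLs₁ h₂ hLs₂
  have hhi := h₁.entropyDensitySup_sub_le_mul_sub_meanEnergy_of_sectorGibbs hU hn0 hn2 (hβ₁.trans hlt) hLs₁ h₂ hLs₂
  nlinarith

/-- **The entropy density is antitone in `β`** (non-decreasing in the temperature): torus limits `ω₁` at `β₁`, `ω₂` at `β₂` of the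
canonical sector Gibbs states with `0 < β₁ < β₂` (`U ≥ 0`, `0 < n < 2`; unrelated torus sequences) satisfy `s̄₂ ≤ s̄₁`
(`s̄₁ − s̄₂ ≥ β₁(e₁ − e₂) ≥ 0`). [cite: Ruelle1969, §7.4 Thm. 7.4.1; cf. §3.4 Thm. 3.4.4 and Fig. 9] [cite: Israel1979, Thm. II.3.2 and Cor. II.3.5; Lemma II.3.1 (finite volume, equality case)] -/
theorem IsTorusLimitOfMixture.entropyDensitySup_anti_of_sectorGibbs (hU : 0 ≤ U) (hn0 : 0 < n) (hn2 : n < 2)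
    {β₁ β₂ : ℝ} (hβ₁ : 0 < β₁) (hlt : β₁ < β₂) {ω₁ ω₂ : InfVolFermionState 2} {Ls₁ Ls₂ : ℕ → ℕ}
    (h₁ : ω₁.IsTorusLimitOfMixture (sectorGibbsCount n) (fun L => sectorGibbsWeightTT' β₁ t t' U n L)
      (fun L => sectorGibbsVectorTT' t t' U n L) Ls₁)
    (hLs₁ : Tendsto Ls₁ atTop atTop)
    (h₂ : ω₂.IsTorusLimitOfMixture (sectorGibbsCount n) (fun L => sectorGibbsWeightTT' β₂ t t' U n L)
      (fun L => sectorGibbsVectorTT' t t' U n L) Ls₂)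
    (hLs₂ : Tendsto Ls₂ atTop atTop) :
    ω₂.entropyDensitySup ≤ ω₁.entropyDensitySup := by
  have hlo := h₁.mul_sub_meanEnergy_le_entropyDensitySup_sub_of_sectorGibbs hU hn0 hn2 hβ₁ hLs₁ h₂ hLs₂
  have he := h₁.meanEnergy_hubbardTTPrime_anti_of_sectorGibbs' hU hn0 hn2 hβ₁ hlt hLs₁ h₂ hLs₂
  nlinarith

/-- **Two torus limits at ONE temperature lie on one supporting line**: if `ω₁`, `ω₂` are torus limits of the canonical sector Gibbs states
at the same `β > 0` (along possibly different torus sequences; `U ≥ 0`, `0 < n < 2`), then `s̄₁ − s̄₂ = β·(e₁ − e₂)` (both attain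
`p(β) = s̄ − β e`). [cite: Israel1979, Thm. II.3.2 and Cor. II.3.5; Lemma II.3.1 (finite volume, equality case)] -/
theorem IsTorusLimitOfMixture.entropyDensitySup_sub_eq_mul_sub_meanEnergy_of_sectorGibbs (hU : 0 ≤ U) (hn0 : 0 < n)
    (hn2 : n < 2) {β : ℝ} (hβ : 0 < β) {ω₁ ω₂ : InfVolFermionState 2} {Ls₁ Ls₂ : ℕ → ℕ}
    (h₁ : ω₁.IsTorusLimitOfMixture (sectorGibbsCount n) (fun L => sectorGibbsWeightTT' β t t' U n L)
      (fun L => sectorGibbsVectorTT' t t' U n L) Ls₁)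
    (hLs₁ : Tendsto Ls₁ atTop atTop)
    (h₂ : ω₂.IsTorusLimitOfMixture (sectorGibbsCount n) (fun L => sectorGibbsWeightTT' β t t' U n L)
      (fun L => sectorGibbsVectorTT' t t' U n L) Ls₂)
    (hLs₂ : Tendsto Ls₂ atTop atTop) :
    ω₁.entropyDensitySup - ω₂.entropyDensitySup =
      β * (ω₁.meanEnergy (hubbardTTPrimeFermionInteraction t t' U) 1 -
        ω₂.meanEnergy (hubbardTTPrimeFermionInteraction t t' U) 1) := by
  have h1 := h₁.entropyDensitySup_sub_mul_eq_pressureTT'_of_sectorGibbs t t' hU hβ hn0 hn2 hLs₁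
  have h2 := h₂.entropyDensitySup_sub_mul_eq_pressureTT'_of_sectorGibbs t t' hU hβ hn0 hn2 hLs₂
  linarith

/-! ### §3 Interval sockets (hot-end caps and cold-end floors valid for every torus limit at the endpoint) -/

/-- **Energy CAP transported to colder temperatures**: if every torus limit at `β₁ > 0` has `e ≤ hi`, then every torus limit at any
`β ≥ β₁` has `e ≤ hi` (`U ≥ 0`, `0 < n < 2`). [cite: Ruelle1969, §7.4 Thm. 7.4.1; cf. §3.4 Thm. 3.4.4 and Fig. 9] -/
theorem IsTorusLimitOfMixture.meanEnergy_hubbardTTPrime_le_of_forall_hot (hU : 0 ≤ U) (hn0 : 0 < n) (hn2 : n < 2)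
    {β₁ β hi : ℝ} (hβ₁ : 0 < β₁) (hβ : β₁ ≤ β)
    (hhi : ∀ (ω₁ : InfVolFermionState 2) (Ls₁ : ℕ → ℕ), Tendsto Ls₁ atTop atTop →
      ω₁.IsTorusLimitOfMixture (sectorGibbsCount n) (fun L => sectorGibbsWeightTT' β₁ t t' U n L)
        (fun L => sectorGibbsVectorTT' t t' U n L) Ls₁ →
      ω₁.meanEnergy (hubbardTTPrimeFermionInteraction t t' U) 1 ≤ hi)
    {ω : InfVolFermionState 2} {Ls : ℕ → ℕ}
    (h : ω.IsTorusLimitOfMixture (sectorGibbsCount n) (fun L => sectorGibbsWeightTT' β t t' U n L)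
      (fun L => sectorGibbsVectorTT' t t' U n L) Ls)
    (hLs : Tendsto Ls atTop atTop) :
    ω.meanEnergy (hubbardTTPrimeFermionInteraction t t' U) 1 ≤ hi := by
  rcases hβ.eq_or_lt with rfl | hlt
  · exact hhi ω Ls hLs h
  · obtain ⟨φ, hφ, ω₁, h₁⟩ := exists_isTorusLimitOfMixture_sectorGibbs_subseq t t' U hn0.le hn2.le β₁
      (Ls := id) tendsto_id
    have hLφ : Tendsto (id ∘ φ) atTop atTop := hφ.tendsto_atTop
    exact (h₁.meanEnergy_hubbardTTPrime_anti_of_sectorGibbs' hU hn0 hn2 hβ₁ hlt hLφ h hLs).trans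
      (hhi ω₁ (id ∘ φ) hLφ h₁)

/-- **Energy FLOOR transported to hotter temperatures**: if every torus limit at `β₂` has `lo ≤ e`, then every torus limit at any
`β ∈ (0, β₂]` has `lo ≤ e` (`U ≥ 0`, `0 < n < 2`). [cite: Ruelle1969, §7.4 Thm. 7.4.1; cf. §3.4 Thm. 3.4.4 and Fig. 9] -/
theorem IsTorusLimitOfMixture.le_meanEnergy_hubbardTTPrime_of_forall_cold (hU : 0 ≤ U) (hn0 : 0 < n) (hn2 : n < 2)
    {β β₂ lo : ℝ} (hβ : 0 < β) (hβ' : β ≤ β₂)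
    (hlo : ∀ (ω₂ : InfVolFermionState 2) (Ls₂ : ℕ → ℕ), Tendsto Ls₂ atTop atTop →
      ω₂.IsTorusLimitOfMixture (sectorGibbsCount n) (fun L => sectorGibbsWeightTT' β₂ t t' U n L)
        (fun L => sectorGibbsVectorTT' t t' U n L) Ls₂ →
      lo ≤ ω₂.meanEnergy (hubbardTTPrimeFermionInteraction t t' U) 1)
    {ω : InfVolFermionState 2} {Ls : ℕ → ℕ}
    (h : ω.IsTorusLimitOfMixture (sectorGibbsCount n) (fun L => sectorGibbsWeightTT' β t t' U n L)
      (fun L => sectorGibbsVectorTT' t t' U n L) Ls)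
    (hLs : Tendsto Ls atTop atTop) :
    lo ≤ ω.meanEnergy (hubbardTTPrimeFermionInteraction t t' U) 1 := by
  rcases hβ'.eq_or_lt with rfl | hlt
  · exact hlo ω Ls hLs h
  · obtain ⟨φ, hφ, ω₂, h₂⟩ := exists_isTorusLimitOfMixture_sectorGibbs_subseq t t' U hn0.le hn2.le β₂
      (Ls := id) tendsto_id
    have hLφ : Tendsto (id ∘ φ) atTop atTop := hφ.tendsto_atTop
    exact (hlo ω₂ (id ∘ φ) hLφ h₂).trans
      (h.meanEnergy_hubbardTTPrime_anti_of_sectorGibbs' hU hn0 hn2 hβ hlt hLs h₂ hLφ)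

/-- **Energy window on a temperature interval** from a hot-end CAP and a cold-end FLOOR, each valid for every torus limit at its endpoint:
every torus limit at `β ∈ [β₁, β₂]` (`0 < β₁`) has `lo ≤ e ≤ hi`. [cite: Ruelle1969, §7.4 Thm. 7.4.1; cf. §3.4 Thm. 3.4.4 and Fig. 9] -/
theorem IsTorusLimitOfMixture.meanEnergy_hubbardTTPrime_mem_Icc_on_interval_of_forall (hU : 0 ≤ U) (hn0 : 0 < n)
    (hn2 : n < 2) {β₁ β₂ β lo hi : ℝ} (hβ₁ : 0 < β₁) (hβ : β₁ ≤ β) (hβ' : β ≤ β₂)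
    (hhi : ∀ (ω₁ : InfVolFermionState 2) (Ls₁ : ℕ → ℕ), Tendsto Ls₁ atTop atTop →
      ω₁.IsTorusLimitOfMixture (sectorGibbsCount n) (fun L => sectorGibbsWeightTT' β₁ t t' U n L)
        (fun L => sectorGibbsVectorTT' t t' U n L) Ls₁ →
      ω₁.meanEnergy (hubbardTTPrimeFermionInteraction t t' U) 1 ≤ hi)
    (hlo : ∀ (ω₂ : InfVolFermionState 2) (Ls₂ : ℕ → ℕ), Tendsto Ls₂ atTop atTop →
      ω₂.IsTorusLimitOfMixture (sectorGibbsCount n) (fun L => sectorGibbsWeightTT' β₂ t t' U n L)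
        (fun L => sectorGibbsVectorTT' t t' U n L) Ls₂ →
      lo ≤ ω₂.meanEnergy (hubbardTTPrimeFermionInteraction t t' U) 1)
    {ω : InfVolFermionState 2} {Ls : ℕ → ℕ}
    (h : ω.IsTorusLimitOfMixture (sectorGibbsCount n) (fun L => sectorGibbsWeightTT' β t t' U n L)
      (fun L => sectorGibbsVectorTT' t t' U n L) Ls)
    (hLs : Tendsto Ls atTop atTop) :
    ω.meanEnergy (hubbardTTPrimeFermionInteraction t t' U) 1 ∈ Set.Icc lo hi :=
  ⟨h.le_meanEnergy_hubbardTTPrime_of_forall_cold hU hn0 hn2 (hβ₁.trans_le hβ) hβ' hlo hLs,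
    h.meanEnergy_hubbardTTPrime_le_of_forall_hot hU hn0 hn2 hβ₁ hβ hhi hLs⟩

/-- **Entropy CAP transported to colder temperatures**: if every torus limit at `β₁ > 0` has `s̄ ≤ hi`, then every torus limit at any
`β ≥ β₁` has `s̄ ≤ hi` (`U ≥ 0`, `0 < n < 2`). [cite: Ruelle1969, §7.4 Thm. 7.4.1; cf. §3.4 Thm. 3.4.4 and Fig. 9] -/
theorem IsTorusLimitOfMixture.entropyDensitySup_le_of_forall_hot (hU : 0 ≤ U) (hn0 : 0 < n) (hn2 : n < 2)
    {β₁ β hi : ℝ} (hβ₁ : 0 < β₁) (hβ : β₁ ≤ β)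
    (hhi : ∀ (ω₁ : InfVolFermionState 2) (Ls₁ : ℕ → ℕ), Tendsto Ls₁ atTop atTop →
      ω₁.IsTorusLimitOfMixture (sectorGibbsCount n) (fun L => sectorGibbsWeightTT' β₁ t t' U n L)
        (fun L => sectorGibbsVectorTT' t t' U n L) Ls₁ →
      ω₁.entropyDensitySup ≤ hi)
    {ω : InfVolFermionState 2} {Ls : ℕ → ℕ}
    (h : ω.IsTorusLimitOfMixture (sectorGibbsCount n) (fun L => sectorGibbsWeightTT' β t t' U n L)
      (fun L => sectorGibbsVectorTT' t t' U n L) Ls)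
    (hLs : Tendsto Ls atTop atTop) :
    ω.entropyDensitySup ≤ hi := by
  rcases hβ.eq_or_lt with rfl | hlt
  · exact hhi ω Ls hLs h
  · obtain ⟨φ, hφ, ω₁, h₁⟩ := exists_isTorusLimitOfMixture_sectorGibbs_subseq t t' U hn0.le hn2.le β₁
      (Ls := id) tendsto_id
    have hLφ : Tendsto (id ∘ φ) atTop atTop := hφ.tendsto_atTop
    exact (h₁.entropyDensitySup_anti_of_sectorGibbs hU hn0 hn2 hβ₁ hlt hLφ h hLs).trans (hhi ω₁ (id ∘ φ) hLφ h₁)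

/-- **Entropy FLOOR transported to hotter temperatures**: if every torus limit at `β₂` has `lo ≤ s̄`, then every torus limit at any
`β ∈ (0, β₂]` has `lo ≤ s̄` (`U ≥ 0`, `0 < n < 2`). [cite: Ruelle1969, §7.4 Thm. 7.4.1; cf. §3.4 Thm. 3.4.4 and Fig. 9] -/
theorem IsTorusLimitOfMixture.le_entropyDensitySup_of_forall_cold (hU : 0 ≤ U) (hn0 : 0 < n) (hn2 : n < 2)
    {β β₂ lo : ℝ} (hβ : 0 < β) (hβ' : β ≤ β₂)
    (hlo : ∀ (ω₂ : InfVolFermionState 2) (Ls₂ : ℕ → ℕ), Tendsto Ls₂ atTop atTop →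
      ω₂.IsTorusLimitOfMixture (sectorGibbsCount n) (fun L => sectorGibbsWeightTT' β₂ t t' U n L)
        (fun L => sectorGibbsVectorTT' t t' U n L) Ls₂ →
      lo ≤ ω₂.entropyDensitySup)
    {ω : InfVolFermionState 2} {Ls : ℕ → ℕ}
    (h : ω.IsTorusLimitOfMixture (sectorGibbsCount n) (fun L => sectorGibbsWeightTT' β t t' U n L)
      (fun L => sectorGibbsVectorTT' t t' U n L) Ls)
    (hLs : Tendsto Ls atTop atTop) :
    lo ≤ ω.entropyDensitySup := by
  rcases hβ'.eq_or_lt with rfl | hlt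
  · exact hlo ω Ls hLs h
  · obtain ⟨φ, hφ, ω₂, h₂⟩ := exists_isTorusLimitOfMixture_sectorGibbs_subseq t t' U hn0.le hn2.le β₂
      (Ls := id) tendsto_id
    have hLφ : Tendsto (id ∘ φ) atTop atTop := hφ.tendsto_atTop
    exact (hlo ω₂ (id ∘ φ) hLφ h₂).trans (h.entropyDensitySup_anti_of_sectorGibbs hU hn0 hn2 hβ hlt hLs h₂ hLφ)

/-- **Entropy window on a temperature interval** from a hot-end CAP and a cold-end FLOOR, each valid for every torus limit at its endpoint:
every torus limit at `β ∈ [β₁, β₂]` (`0 < β₁`) has `lo ≤ s̄ ≤ hi`. [cite: Ruelle1969, §7.4 Thm. 7.4.1; cf. §3.4 Thm. 3.4.4 and Fig. 9] -/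
theorem IsTorusLimitOfMixture.entropyDensitySup_mem_Icc_on_interval_of_forall (hU : 0 ≤ U) (hn0 : 0 < n) (hn2 : n < 2)
    {β₁ β₂ β lo hi : ℝ} (hβ₁ : 0 < β₁) (hβ : β₁ ≤ β) (hβ' : β ≤ β₂)
    (hhi : ∀ (ω₁ : InfVolFermionState 2) (Ls₁ : ℕ → ℕ), Tendsto Ls₁ atTop atTop →
      ω₁.IsTorusLimitOfMixture (sectorGibbsCount n) (fun L => sectorGibbsWeightTT' β₁ t t' U n L)
        (fun L => sectorGibbsVectorTT' t t' U n L) Ls₁ →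
      ω₁.entropyDensitySup ≤ hi)
    (hlo : ∀ (ω₂ : InfVolFermionState 2) (Ls₂ : ℕ → ℕ), Tendsto Ls₂ atTop atTop →
      ω₂.IsTorusLimitOfMixture (sectorGibbsCount n) (fun L => sectorGibbsWeightTT' β₂ t t' U n L)
        (fun L => sectorGibbsVectorTT' t t' U n L) Ls₂ →
      lo ≤ ω₂.entropyDensitySup)
    {ω : InfVolFermionState 2} {Ls : ℕ → ℕ}
    (h : ω.IsTorusLimitOfMixture (sectorGibbsCount n) (fun L => sectorGibbsWeightTT' β t t' U n L)
      (fun L => sectorGibbsVectorTT' t t' U n L) Ls)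
    (hLs : Tendsto Ls atTop atTop) :
    ω.entropyDensitySup ∈ Set.Icc lo hi :=
  ⟨h.le_entropyDensitySup_of_forall_cold hU hn0 hn2 (hβ₁.trans_le hβ) hβ' hlo hLs,
    h.entropyDensitySup_le_of_forall_hot hU hn0 hn2 hβ₁ hβ hhi hLs⟩

end InfVolFermionState

end Literature.MathematicalPhysics.QuantumLattice
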